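import Mathlib
import Literature.RepresentationTheory.FiniteGroups.KLRGradedCellularBasis
import Literature.RepresentationTheory.FiniteGroups.VershikKerovMaxDegreeProofs
import Literature.Combinatorics.Enumerative.PartitionNumberUpperBound

/-!
# `SnSubsetDichotomy.NoThresholdSubsetTriple`, line `klr-graded-polynomial-method`:
# stub `stub_shapeTailCount` (from a per-shape bound to a `TableauPair` count)

If every shape `μ ⊢ n` with a property `P` has `(f^μ)² ≤ n! · e^{-κn}` for `n ≥ n₁` (`κ > 0`),
then the same-shape pairs of standard tableaux `(μ, S, T)` whose shape has `P` number at most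
`n! · e^{-cn}` for large `n`, with `c = κ/4`:
* `#{(μ, S, T) : P μ} = ∑_{μ : P μ} (f^μ)²` (`Fintype.card_sigma`,
  `numStandardTableaux_eq_card_stdFilling`);
* each term is `≤ n! · e^{-κn}`, and there are at most `p(n) ≤ e^{nκ/2 + π²/(3κ)}` shapes
  (`card_partition_le_exp_add` with `t = κ/2`);
* `nκ/2 + π²/(3κ) - κn ≤ -(κ/4) n` once `π²/(3κ) ≤ κ n/4`, i.e. `n ≥ ⌈4π²/(3κ²)⌉`.
-/

namespace Summit.MatrixMultiplication.MatrixMultiplication.Theorems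

open Literature.RepresentationTheory.FiniteGroups (TableauPair)
open Literature.NumberTheory.DiophantineGeometry

/-- Counting same-shape pairs of standard tableaux with a shape condition `P`:
`#{(μ, S, T) : P μ} = ∑_{μ : P μ} (f^μ)²`. [folklore] -/
private theorem card_subtype_tableauPair_eq_sum_sq (n : ℕ) (P : Nat.Partition n → Prop)
    [DecidablePred P] :
    Nat.card {i : TableauPair n // P i.1} =
      ∑ μ ∈ Finset.univ.filter P, numStandardTableaux μ ^ 2 := by
  classical
  rw [Nat.card_eq_fintype_card, Fintype.card_subtype, Finset.card_eq_sum_ones, Finset.sum_filter,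
    Finset.sum_filter]
  unfold TableauPair
  rw [Fintype.sum_sigma]
  refine Finset.sum_congr rfl fun μ _ => ?_
  split_ifs with h
  · rw [Finset.sum_const, smul_eq_mul, mul_one, Finset.card_univ, Fintype.card_prod, sq,
      numStandardTableaux_eq_card_stdFilling, Nat.card_eq_fintype_card]
  · rw [Finset.sum_const_zero]

set_option linter.dupNamespace false in -- deliberate Summit.<S>.<P> duplicate
/-- **From a per-shape bound to a `TableauPair` count.** If every shape `μ ⊢ n` with property
`P` has `(f^μ)² ≤ n! · e^{-κn}` for `n ≥ n₁` (`κ > 0`), then for large `n` the same-shape tableau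
pairs `(μ, S, T)` whose shape has `P` number at most `n! · e^{-cn}` (`c = κ/4`):
`#{(μ, S, T) : P μ} = ∑_{μ : P μ} (f^μ)² ≤ p(n) · n! e^{-κn}` with
`p(n) ≤ e^{κn/2 + π²/(3κ)}` (`card_partition_le_exp_add`) and `π²/(3κ) ≤ κ n/4` for
`n ≥ ⌈4π²/(3κ²)⌉`. [folklore] -/
theorem stub_shapeTailCount : ∀ (P : (n : ℕ) → Nat.Partition n → Prop) (κ : ℝ), 0 < κ → (∃ n₁ : ℕ, ∀ n ≥ n₁, ∀ μ : Nat.Partition n, P n μ → ((Literature.NumberTheory.DiophantineGeometry.numStandardTableaux μ : ℕ) : ℝ) ^ 2 ≤ (n.factorial : ℝ) * Real.exp (-(κ * (n : ℝ)))) → ∃ c : ℝ, 0 < c ∧ ∃ n₀ : ℕ, ∀ n ≥ n₀, (Nat.card {i : TableauPair n // P n i.1} : ℝ) ≤ (n.factorial : ℝ) * Real.exp (-(c * (n : ℝ))) := by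
  rintro P κ hκ ⟨n₁, hP⟩
  classical
  -- threshold: `π²/(6 (κ/2)) = π²/(3κ) ≤ κ n/4` once `n ≥ ⌈4π²/(3κ²)⌉`
  refine ⟨κ / 4, by positivity, max n₁ ⌈4 * (Real.pi ^ 2 / (6 * (κ / 2))) / κ⌉₊, fun n hn => ?_⟩
  have hn₁ : n₁ ≤ n := le_trans (le_max_left _ _) hn
  have hn₂ : ⌈4 * (Real.pi ^ 2 / (6 * (κ / 2))) / κ⌉₊ ≤ n := le_trans (le_max_right _ _) hn
  have hAn : 4 * (Real.pi ^ 2 / (6 * (κ / 2))) / κ ≤ n :=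
    le_trans (Nat.le_ceil _) (by exact_mod_cast hn₂)
  have hAn' : Real.pi ^ 2 / (6 * (κ / 2)) ≤ κ / 4 * n := by
    rw [div_le_iff₀ hκ] at hAn
    linarith
  -- counting: `#{(μ, S, T) : P μ} = ∑_{μ : P μ} (f^μ)²`
  have hcount : (Nat.card {i : TableauPair n // P n i.1} : ℝ) =
      ∑ μ ∈ Finset.univ.filter (P n), ((numStandardTableaux μ : ℕ) : ℝ) ^ 2 := by
    rw [card_subtype_tableauPair_eq_sum_sq n (P n)]
    push_cast
    rfl
  -- per-shape bound on the filter
  have hB0 : 0 ≤ (n.factorial : ℝ) * Real.exp (-(κ * (n : ℝ))) := by positivity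
  have hterm : ∀ μ ∈ Finset.univ.filter (P n),
      ((numStandardTableaux μ : ℕ) : ℝ) ^ 2 ≤ (n.factorial : ℝ) * Real.exp (-(κ * (n : ℝ))) := by
    intro μ hμ
    rw [Finset.mem_filter] at hμ
    exact hP n hn₁ μ hμ.2
  have hsum : ∑ μ ∈ Finset.univ.filter (P n), ((numStandardTableaux μ : ℕ) : ℝ) ^ 2 ≤
      (Finset.univ.filter (P n)).card * ((n.factorial : ℝ) * Real.exp (-(κ * (n : ℝ)))) := by
    calc ∑ μ ∈ Finset.univ.filter (P n), ((numStandardTableaux μ : ℕ) : ℝ) ^ 2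
        ≤ ∑ _μ ∈ Finset.univ.filter (P n), (n.factorial : ℝ) * Real.exp (-(κ * (n : ℝ))) :=
          Finset.sum_le_sum hterm
      _ = (Finset.univ.filter (P n)).card * ((n.factorial : ℝ) * Real.exp (-(κ * (n : ℝ)))) := by
          rw [Finset.sum_const, nsmul_eq_mul]
  -- number of shapes
  have hcardS : ((Finset.univ.filter (P n)).card : ℝ) ≤
      Real.exp (n * (κ / 2) + Real.pi ^ 2 / (6 * (κ / 2))) := by
    have h1 : (Finset.univ.filter (P n)).card ≤ Fintype.card (Nat.Partition n) :=
      Finset.card_le_univ _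
    have h2 : ((Finset.univ.filter (P n)).card : ℝ) ≤ Fintype.card (Nat.Partition n) := by
      exact_mod_cast h1
    exact h2.trans (Literature.Combinatorics.Enumerative.card_partition_le_exp_add (by positivity) n)
  -- the exponent bookkeeping
  have hexp_le : n * (κ / 2) + Real.pi ^ 2 / (6 * (κ / 2)) + -(κ * (n : ℝ)) ≤ -(κ / 4 * (n : ℝ)) := by
    linarith
  rw [hcount]
  calc ∑ μ ∈ Finset.univ.filter (P n), ((numStandardTableaux μ : ℕ) : ℝ) ^ 2
      ≤ (Finset.univ.filter (P n)).card * ((n.factorial : ℝ) * Real.exp (-(κ * (n : ℝ)))) := hsum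
    _ ≤ Real.exp (n * (κ / 2) + Real.pi ^ 2 / (6 * (κ / 2))) *
          ((n.factorial : ℝ) * Real.exp (-(κ * (n : ℝ)))) :=
        mul_le_mul_of_nonneg_right hcardS hB0
    _ = (n.factorial : ℝ) * (Real.exp (n * (κ / 2) + Real.pi ^ 2 / (6 * (κ / 2))) *
          Real.exp (-(κ * (n : ℝ)))) := by ring
    _ = (n.factorial : ℝ) *
          Real.exp (n * (κ / 2) + Real.pi ^ 2 / (6 * (κ / 2)) + -(κ * (n : ℝ))) := by
        rw [← Real.exp_add]
    _ ≤ (n.factorial : ℝ) * Real.exp (-(κ / 4 * (n : ℝ))) :=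
        mul_le_mul_of_nonneg_left (Real.exp_le_exp.mpr hexp_le) (Nat.cast_nonneg _)

end Summit.MatrixMultiplication.MatrixMultiplication.Theorems
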